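import Mathlib
import HarnessLib
import Summits.SmoothPoincare4.SmoothPoincare4.Theses.ThreeFibres

/-!
# Birth skeleton (BC3) — crux `ThreeFibres.AreaBelowThreeFibres` (stmt-SmoothPoincare4-14758)

Route `route-SmoothPoincare4-ThreeFibres`, crux #2 `AreaBelowThreeFibres` (AREA₁, Diff-orbit form): every `C^∞`
embedded sphere `f : S² → Q := S² × S²` in the fibre class (homotopic to `p ↦ (x, p)`) with simply connected
complement is carried by some diffeomorphism `ψ` of `Q` to a fibre-class sphere of Hausdorff 2-measure
`μH[2](range (ψ ∘ f)) < 3 · μH[2](S²)` ("area below three fibres").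

THE LINE = the route's own foreseen glued split of this node (route file, TWO-LAYER PLAN: "C₁ SheetDescent …;
C₂ (support, provable): regular values exist and carry odd sheet counts (Sard + degree), and a sphere with n = 1 is
carried onto a fibre (LightBulbFibre) hence to measure μH[2](S²) < 3 μH[2](S²); glue C₁ → C₂ → AreaBelowThreeFibres
by well-founded induction on n"), typed WITHOUT a `sheetNumber` definition (no new vocabulary: a SHEET COUNT of `f`
is a regular value `y` of `pr₂ ∘ f` together with the finite set of sheets over it, written inline), so that every
stub is stated over Mathlib + the route file only and the induction runs on the witnessed odd count `k`:

* `stub_odd_regular_sheet` (C₂a, SARD + MOD-2 DEGREE; support-sized, known): a `C^∞` embedded fibre-class sphere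
  has a regular height `y` (`d(pr₂ ∘ f)` onto at every sheet over `y`) whose sheets form a finite set of ODD
  cardinality (`deg₂(pr₂ ∘ f) = deg₂(id) = 1`). Leans on: tree `Literature.Analysis.Calculus.sard_holds`
  (Sard, proved) + chart transfer as in `Literature.Topology.FourManifolds.CircleMapRegularValues`; finiteness of
  regular fibres (inverse function theorem, compactness); mod-2 degree / `not_nullhomotopic_id_sphere`
  (`Literature.Topology.FourManifolds.SurgeryGluckIrreducible`, proved from the tree's singular homology). Size L.
* `stub_one_sheet_below_three` (C₂b, LIGHT BULB BASE; known modulo Gabai): a `C^∞` embedded fibre-class sphere with a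
  ONE-SHEET regular height is carried by a diffeomorphism of `Q` to a fibre-class sphere of area below three fibres.
  Leans on: route support item `ThreeFibres.LightBulbFibre` (stmt-SmoothPoincare4-14762) = Literature
  `Gabai2020_thm_1_9_lightBulb.diffOrbit` (PROVED from the named fact `Gabai2020_thm_1_9_lightBulb`, Gabai 2020
  Thm 1.9): `φ ∘ f` IS a fibre inclusion `p ↦ (x, p)`, which is fibre-class with `G := F`, and has measure exactly
  `μH[2](S²)` (isometric for the sup metric) with `0 < μH[2](S²) < ⊤` — the refuter's sorry-free Evidence.lean on
  this item (`fibre_area`, `measure_sphere_pos`, `measure_sphere_lt_top`, `standard_fibre_passes`). Size M given the fact.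
* `stub_sheet_descent` (C₁, THE LOAD-BEARING STUB = the card's SheetDescent in witnessed form): if a `C^∞` embedded
  fibre-class sphere with simply connected complement has a regular height with exactly `k` sheets, `k ≥ 3` odd,
  then some diffeomorphism `ψ` of `Q` carries it to a fibre-class sphere having a regular height with an odd number
  `j < k` of sheets. Open (crux-hard: for the MINIMAL odd count it is the `n ↦ n − 2` move of the card's grid
  calculus / band cancellation; for a non-minimal count `ψ = refl` works). Implied by the crux plus the provable
  support item `ThreeFibresSheet` (Theorem A: area below three fibres ⇒ a one-sheet height; see
  `sheetDescent_of_crux` below, sorry-free), so it adds no falsity risk beyond AREA₁ itself.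
* `areaBelowThreeFibres_of_pieces : C₂a-sig → C₂b-sig → C₁-sig → (AREA₁ unfolded)` — THE REAL COMPOSITION,
  sorry-free: strong induction on the odd sheet count `k` (`k = 1`: light bulb base; `k ≥ 3`: descend, transport the
  hypotheses along `ψ₁` — `ψ₁ ∘ f` is again a `C^∞` embedding (`isSmoothEmbedding_diffeomorph_comp`, the chart
  transport of Mathlib's immersion normal form, as in the route's `closes`) and has simply connected complement
  (`simplyConnectedSpace_compl_range_comp`, Mathlib `Homeomorph.isSimplyConnected_image`) — apply the induction
  hypothesis at `j < k` and compose the two diffeomorphisms).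
* `AreaBelowThreeFibres_of : AreaBelowThreeFibres` — THE SKELETON THEOREM: the crux BY NAME from the three declared
  stubs through the composition (the file's only theorem whose head is the crux; `ledger skeleton check` shape —
  the skeleton theorem may take no hypotheses other than registered obligations, so the implication content lives
  in `areaBelowThreeFibres_of_pieces` and `_of` discharges it with the stubs).

`sorry` occurs ONLY in the three `stub_*` theorems.

## Disproof used

None exists yet: `ledger crux ls stmt-SmoothPoincare4-14758` shows no `Disproof.lean`, no dead lines, no landed
`Negative/` lemma (2026-08-17). The refuter evidence on the item (crux-attack, 2026-08-15, sorry-free) certifies the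
typing this skeleton inherits: sup metric on `Q`, `0 < μH[2](S²) < ⊤`, the standard fibre passes with `ψ = refl`,
the `SimplyConnectedSpace (range f)ᶜ` hypothesis is not droppable. `ledger negatives --problem SmoothPoincare4`: no
refuted statement about sheet counts / fibre-class spheres in `S² × S²`.

## BC3 probes

See the registrar's NOTES.md / the evidence note: for each stub `X`, `X → AreaBelowThreeFibres` and
`X → SmoothPoincare4` by `first | exact? | simpa | aesop` (files `bc/probe_*.lean`) — results recorded there.

## References

* D. Gabai, *The 4-dimensional light bulb theorem*, JAMS 33 (2020), Thm 1.9 (arXiv:1705.09989). [Gabai2020]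
* H. Federer, *Geometric Measure Theory* (1969), 2.10.25 (Eilenberg's inequality). [Federer1969]
* A. Sard, Bull. AMS 48 (1942). [Sard1942]  J. Milnor, *Topology from the differentiable viewpoint* (1965), §4
  (mod-2 degree). [MilnorTFDV1965]
* J. Eells, J. C. Wood, Topology 15 (1976) (harmonic spheres; levels 4π(1+2ℕ)). [EellsWood1976]
-/

-- `Summit.<Summit>.<Problem>`: single-conjunct summit, the duplicate component is mandated (CONVENTIONS §2).
set_option linter.dupNamespace false
set_option linter.unusedVariables false

noncomputable section

namespace Summit.SmoothPoincare4.SmoothPoincare4.Cruxes.AreaBelowThreeFibres.Birth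

open scoped Manifold ContDiff MeasureTheory Topology
open Set Function MeasureTheory
open Summit.SmoothPoincare4.SmoothPoincare4.Theses.ThreeFibres

/-! ## The three registered stubs

Vocabulary (all inline, Mathlib only): `S² := Metric.sphere (0 : EuclideanSpace ℝ (Fin 3)) 1` (model `𝓡 2`),
`Q := S² × S²` (model `(𝓡 2).prod (𝓡 2)`); "fibre class" of `f` is the crux's clause
`∃ x F G, ⇑F = f ∧ ⇑G = (fun p => (x, p)) ∧ F.Homotopic G`; a "regular sheet count `k` of `f`" is
`∃ y, (∀ p, (f p).2 = y → Surjective (mfderiv (𝓡 2) (𝓡 2) (fun q => (f q).2) p)) ∧ ∃ s : Finset S², (∀ p, p ∈ s ↔ (f p).2 = y) ∧ s.card = k`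
(`y` a regular value of `pr₂ ∘ f` — i.e. the horizontal sphere `S² × {y}` is transverse to `f` — met by exactly
the `k` sheets `s`). -/

/-- **Stub C₂a `stub_odd_regular_sheet` — regular heights exist and carry ODD sheet counts (Sard + mod-2 degree).**
A `C^∞` embedded sphere `f : S² → S² × S²` homotopic to a fibre inclusion has a regular value `y` of `pr₂ ∘ f`
whose (finite) set of sheets has odd cardinality. Why true: Sard (regular values have full measure), regular fibres
of a map between compact surfaces are finite, and their count is `≡ deg₂(pr₂ ∘ f) = deg₂(id_{S²}) = 1 (mod 2)`.
Known; size L in Lean (tree: `Literature.Analysis.Calculus.sard_holds`, `not_nullhomotopic_id_sphere`).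
[Sard1942] [MilnorTFDV1965, §4] -/
theorem stub_odd_regular_sheet
    (f : (Metric.sphere (0 : EuclideanSpace ℝ (Fin 3)) 1) →
      (Metric.sphere (0 : EuclideanSpace ℝ (Fin 3)) 1) × (Metric.sphere (0 : EuclideanSpace ℝ (Fin 3)) 1))
    (hemb : Manifold.IsSmoothEmbedding (𝓡 2) ((𝓡 2).prod (𝓡 2)) ∞ f)
    (hcls : ∃ (x : Metric.sphere (0 : EuclideanSpace ℝ (Fin 3)) 1)
      (F G : C(Metric.sphere (0 : EuclideanSpace ℝ (Fin 3)) 1,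
        (Metric.sphere (0 : EuclideanSpace ℝ (Fin 3)) 1) × (Metric.sphere (0 : EuclideanSpace ℝ (Fin 3)) 1))),
      ⇑F = f ∧ ⇑G = (fun p => (x, p)) ∧ F.Homotopic G) :
    ∃ y : Metric.sphere (0 : EuclideanSpace ℝ (Fin 3)) 1,
      (∀ p : Metric.sphere (0 : EuclideanSpace ℝ (Fin 3)) 1, (f p).2 = y →
        Function.Surjective ⇑(mfderiv (𝓡 2) (𝓡 2) (fun q => (f q).2) p)) ∧
      ∃ s : Finset (Metric.sphere (0 : EuclideanSpace ℝ (Fin 3)) 1),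
        (∀ p : Metric.sphere (0 : EuclideanSpace ℝ (Fin 3)) 1, p ∈ s ↔ (f p).2 = y) ∧ Odd s.card := by
  sorry

/-- **Stub C₂b `stub_one_sheet_below_three` — the light bulb base.** A `C^∞` embedded fibre-class sphere
`f : S² → S² × S²` with a ONE-SHEET regular height (some horizontal sphere `S² × {y}` is a transverse sphere met
exactly once — verbatim the hypothesis of the route item `LightBulbFibre`) is carried by a diffeomorphism `ψ` of
`S² × S²` to a fibre-class sphere of Hausdorff 2-measure `< 3 · μH[2](S²)`. Why true: Gabai's light bulb theorem
(route item `LightBulbFibre`, = `Literature.Topology.FourManifolds.Gabai2020_thm_1_9_lightBulb.diffOrbit`, proved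
from the named fact) gives `φ` with `φ ∘ f = (p ↦ (x, p))` EXACTLY, a fibre-class map of measure `μH[2](S²)`
(isometric embedding for the sup metric) and `0 < μH[2](S²) < ⊤` (refuter Evidence.lean on stmt-14758, sorry-free).
Known modulo the Gabai fact; size M. [Gabai2020, Thm 1.9] [Federer1969, 2.10.25] -/
theorem stub_one_sheet_below_three
    (f : (Metric.sphere (0 : EuclideanSpace ℝ (Fin 3)) 1) →
      (Metric.sphere (0 : EuclideanSpace ℝ (Fin 3)) 1) × (Metric.sphere (0 : EuclideanSpace ℝ (Fin 3)) 1))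
    (hemb : Manifold.IsSmoothEmbedding (𝓡 2) ((𝓡 2).prod (𝓡 2)) ∞ f)
    (hcls : ∃ (x : Metric.sphere (0 : EuclideanSpace ℝ (Fin 3)) 1)
      (F G : C(Metric.sphere (0 : EuclideanSpace ℝ (Fin 3)) 1,
        (Metric.sphere (0 : EuclideanSpace ℝ (Fin 3)) 1) × (Metric.sphere (0 : EuclideanSpace ℝ (Fin 3)) 1))),
      ⇑F = f ∧ ⇑G = (fun p => (x, p)) ∧ F.Homotopic G)
    (hone : ∃ y : Metric.sphere (0 : EuclideanSpace ℝ (Fin 3)) 1,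
      (∃! p : Metric.sphere (0 : EuclideanSpace ℝ (Fin 3)) 1, (f p).2 = y) ∧
      ∀ p : Metric.sphere (0 : EuclideanSpace ℝ (Fin 3)) 1, (f p).2 = y →
        Function.Surjective ⇑(mfderiv (𝓡 2) (𝓡 2) (fun q => (f q).2) p)) :
    ∃ ψ : ((Metric.sphere (0 : EuclideanSpace ℝ (Fin 3)) 1) × (Metric.sphere (0 : EuclideanSpace ℝ (Fin 3)) 1)) ≃ₘ⟮(𝓡 2).prod (𝓡 2), (𝓡 2).prod (𝓡 2)⟯
        ((Metric.sphere (0 : EuclideanSpace ℝ (Fin 3)) 1) × (Metric.sphere (0 : EuclideanSpace ℝ (Fin 3)) 1)),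
      (∃ (x : Metric.sphere (0 : EuclideanSpace ℝ (Fin 3)) 1)
        (F G : C(Metric.sphere (0 : EuclideanSpace ℝ (Fin 3)) 1,
          (Metric.sphere (0 : EuclideanSpace ℝ (Fin 3)) 1) × (Metric.sphere (0 : EuclideanSpace ℝ (Fin 3)) 1))),
        ⇑F = ⇑ψ ∘ f ∧ ⇑G = (fun p => (x, p)) ∧ F.Homotopic G) ∧
      μH[2] (Set.range (⇑ψ ∘ f)) < 3 * μH[2] (Set.univ : Set (Metric.sphere (0 : EuclideanSpace ℝ (Fin 3)) 1)) := by
  sorry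

/-- **Stub C₁ `stub_sheet_descent` — SHEET DESCENT, witnessed form (the load-bearing stub).** If a `C^∞` embedded
fibre-class sphere `f : S² → S² × S²` with simply connected complement has a regular height with exactly `k` sheets,
`k ≥ 3` odd, then some diffeomorphism `ψ` of `S² × S²` carries `f` to a fibre-class sphere with a regular height of
odd sheet count `j < k`. For the minimal odd count this is the card's `n(ψ ∘ f) < n(f)` (the `n ↦ n − 2` move: cancel
two oppositely-signed sheets over a common regular disc by an ambient isotopy — grid calculus K1/K3, band
cancellation / braid–Markov grid moves; the variational sibling: below the `12π` level); for a non-minimal count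
`ψ = refl` does it. Open, crux-hard (a sphere stuck at `≥ 3` sheets in its whole Diff-orbit is an exotic
1-stably-standard `S⁴`); implied by AREA₁ + Theorem A (`sheetDescent_of_crux` below), so no extra falsity risk.
[arXiv:1705.09989, §10] [EellsWood1976] [Federer1969, 2.10.25] -/
theorem stub_sheet_descent
    (f : (Metric.sphere (0 : EuclideanSpace ℝ (Fin 3)) 1) →
      (Metric.sphere (0 : EuclideanSpace ℝ (Fin 3)) 1) × (Metric.sphere (0 : EuclideanSpace ℝ (Fin 3)) 1))
    (hemb : Manifold.IsSmoothEmbedding (𝓡 2) ((𝓡 2).prod (𝓡 2)) ∞ f)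
    (hcls : ∃ (x : Metric.sphere (0 : EuclideanSpace ℝ (Fin 3)) 1)
      (F G : C(Metric.sphere (0 : EuclideanSpace ℝ (Fin 3)) 1,
        (Metric.sphere (0 : EuclideanSpace ℝ (Fin 3)) 1) × (Metric.sphere (0 : EuclideanSpace ℝ (Fin 3)) 1))),
      ⇑F = f ∧ ⇑G = (fun p => (x, p)) ∧ F.Homotopic G)
    (hsc : SimplyConnectedSpace ↥(Set.range f)ᶜ)
    (k : ℕ) (hk : 3 ≤ k) (hodd : Odd k)
    (hcount : ∃ y : Metric.sphere (0 : EuclideanSpace ℝ (Fin 3)) 1,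
      (∀ p : Metric.sphere (0 : EuclideanSpace ℝ (Fin 3)) 1, (f p).2 = y →
        Function.Surjective ⇑(mfderiv (𝓡 2) (𝓡 2) (fun q => (f q).2) p)) ∧
      ∃ s : Finset (Metric.sphere (0 : EuclideanSpace ℝ (Fin 3)) 1),
        (∀ p : Metric.sphere (0 : EuclideanSpace ℝ (Fin 3)) 1, p ∈ s ↔ (f p).2 = y) ∧ s.card = k) :
    ∃ ψ : ((Metric.sphere (0 : EuclideanSpace ℝ (Fin 3)) 1) × (Metric.sphere (0 : EuclideanSpace ℝ (Fin 3)) 1)) ≃ₘ⟮(𝓡 2).prod (𝓡 2), (𝓡 2).prod (𝓡 2)⟯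
        ((Metric.sphere (0 : EuclideanSpace ℝ (Fin 3)) 1) × (Metric.sphere (0 : EuclideanSpace ℝ (Fin 3)) 1)),
      (∃ (x : Metric.sphere (0 : EuclideanSpace ℝ (Fin 3)) 1)
        (F G : C(Metric.sphere (0 : EuclideanSpace ℝ (Fin 3)) 1,
          (Metric.sphere (0 : EuclideanSpace ℝ (Fin 3)) 1) × (Metric.sphere (0 : EuclideanSpace ℝ (Fin 3)) 1))),
        ⇑F = ⇑ψ ∘ f ∧ ⇑G = (fun p => (x, p)) ∧ F.Homotopic G) ∧
      ∃ j : ℕ, j < k ∧ Odd j ∧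
        ∃ y : Metric.sphere (0 : EuclideanSpace ℝ (Fin 3)) 1,
          (∀ p : Metric.sphere (0 : EuclideanSpace ℝ (Fin 3)) 1, ((⇑ψ ∘ f) p).2 = y →
            Function.Surjective ⇑(mfderiv (𝓡 2) (𝓡 2) (fun q => ((⇑ψ ∘ f) q).2) p)) ∧
          ∃ s : Finset (Metric.sphere (0 : EuclideanSpace ℝ (Fin 3)) 1),
            (∀ p : Metric.sphere (0 : EuclideanSpace ℝ (Fin 3)) 1, p ∈ s ↔ ((⇑ψ ∘ f) p).2 = y) ∧ s.card = j := by
  sorry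

/-! ## Sorry-free infrastructure: transporting the hypotheses along a diffeomorphism of `S² × S²` -/

/-- Local notation (infrastructure and composition only; the stubs above are spelled out): the round 2-sphere. -/
local notation "𝕊²" => (Metric.sphere (0 : EuclideanSpace ℝ (Fin 3)) 1)

/-- **`ψ ∘ g` is again a `C^∞` embedding** for a diffeomorphism `ψ` of `S² × S²` and a `C^∞` embedding
`g : S² → S² × S²`: the topological part from the homeomorphism `ψ`, the immersion part by transporting the
codomain chart of Mathlib's `IsImmersionAtOfComplement` normal form along `ψ.symm` (verbatim the inline argument
of the route's `closes`; Mathlib's `IsSmoothEmbedding.comp` is still `proof_wanted`). [folklore] -/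
theorem isSmoothEmbedding_diffeomorph_comp
    (ψ : (𝕊² × 𝕊²) ≃ₘ⟮(𝓡 2).prod (𝓡 2), (𝓡 2).prod (𝓡 2)⟯ (𝕊² × 𝕊²)) {g : 𝕊² → 𝕊² × 𝕊²}
    (hg : Manifold.IsSmoothEmbedding (𝓡 2) ((𝓡 2).prod (𝓡 2)) ∞ g) :
    Manifold.IsSmoothEmbedding (𝓡 2) ((𝓡 2).prod (𝓡 2)) ∞ (⇑ψ ∘ g) := by
  refine ⟨?_, ψ.toHomeomorph.isEmbedding.comp hg.isEmbedding⟩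
  obtain ⟨F, _, _, hF0⟩ := hg.isImmersion
  refine ⟨F, inferInstance, inferInstance, fun x => ?_⟩
  have h := hF0 x
  set c := ψ.symm.toHomeomorph.toOpenPartialHomeomorph ≫ₕ h.codChart with hc
  have hcatlas : c ∈ IsManifold.maximalAtlas ((𝓡 2).prod (𝓡 2)) ∞ (𝕊² × 𝕊²) := by
    rw [IsManifold.mem_maximalAtlas_iff_contMDiffOn]
    constructor
    · have h1 := contMDiffOn_of_mem_maximalAtlas h.codChart_mem_maximalAtlas
      have : ContMDiffOn ((𝓡 2).prod (𝓡 2)) ((𝓡 2).prod (𝓡 2)) ∞ (h.codChart ∘ ψ.symm) c.source := by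
        refine h1.comp ψ.symm.contMDiff.contMDiffOn ?_
        intro y hy
        simpa [hc] using hy
      exact this.congr fun y _ => by simp [hc]
    · have h1 := contMDiffOn_symm_of_mem_maximalAtlas h.codChart_mem_maximalAtlas
      have : ContMDiffOn ((𝓡 2).prod (𝓡 2)) ((𝓡 2).prod (𝓡 2)) ∞ (ψ ∘ h.codChart.symm) c.target := by
        refine ψ.contMDiff.comp_contMDiffOn (h1.mono ?_)
        intro y hy
        simpa [hc] using hy
      exact this.congr fun y _ => by simp [hc]
  refine Manifold.IsImmersionAtOfComplement.mk_of_charts h.equiv h.domChart c h.mem_domChart_source ?_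
    h.domChart_mem_maximalAtlas hcatlas ?_ ?_
  · simpa [hc] using h.mem_codChart_source
  · intro y hy
    simpa [hc] using h.source_subset_preimage_source hy
  · intro y hy
    have := h.writtenInCharts hy
    simp only [Function.comp_apply] at this ⊢
    rw [← this]
    simp [hc, OpenPartialHomeomorph.extend]

/-- **The complement of `range (ψ ∘ g)` is simply connected if the complement of `range g` is**, for a
diffeomorphism (indeed any homeomorphism) `ψ`: `(range (ψ ∘ g))ᶜ = ψ '' (range g)ᶜ` and simple connectivity of a
set is invariant under homeomorphisms (Mathlib `Homeomorph.isSimplyConnected_image`). [folklore] -/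
theorem simplyConnectedSpace_compl_range_comp
    (ψ : (𝕊² × 𝕊²) ≃ₘ⟮(𝓡 2).prod (𝓡 2), (𝓡 2).prod (𝓡 2)⟯ (𝕊² × 𝕊²)) {g : 𝕊² → 𝕊² × 𝕊²}
    (hsc : SimplyConnectedSpace ↥(Set.range g)ᶜ) :
    SimplyConnectedSpace ↥(Set.range (⇑ψ ∘ g))ᶜ := by
  have e : (Set.range (⇑ψ ∘ g))ᶜ = ⇑ψ.toHomeomorph '' (Set.range g)ᶜ := by
    rw [Set.range_comp, Set.image_compl_eq ψ.toHomeomorph.bijective]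
    rfl
  rw [e]
  exact (ψ.toHomeomorph.isSimplyConnected_image (s := (Set.range g)ᶜ)).mpr hsc

/-! ## The composition: the three stubs prove AREA₁ (strong induction on the odd sheet count) -/

/-- **Composition with explicit hypotheses** (`C₂a-sig → C₂b-sig → C₁-sig → AREA₁`, the conclusion written as
the crux's one-step unfolding so that `AreaBelowThreeFibres_of` below is the file's only theorem whose head is the
crux name). Proof: given `f`, stub C₂a yields a regular height with an odd number `k` of sheets; by strong induction
on `k`: `k = 1` is a one-sheet height and stub C₂b finishes; `k ≥ 3`: stub C₁ gives `ψ₁` and an odd count `j < k`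
for `ψ₁ ∘ f`, which is again a `C^∞` embedding (`isSmoothEmbedding_diffeomorph_comp`), fibre-class (from C₁) and
has simply connected complement (`simplyConnectedSpace_compl_range_comp`); the induction hypothesis gives `ψ₂`,
and `ψ := ψ₁.trans ψ₂` works since `⇑(ψ₁.trans ψ₂) ∘ f = ⇑ψ₂ ∘ (⇑ψ₁ ∘ f)`. Sorry-free, standard axioms. [folklore] -/
theorem areaBelowThreeFibres_of_pieces
    (hA : ∀ f : 𝕊² → 𝕊² × 𝕊², Manifold.IsSmoothEmbedding (𝓡 2) ((𝓡 2).prod (𝓡 2)) ∞ f →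
      (∃ (x : 𝕊²) (F G : C(𝕊², 𝕊² × 𝕊²)), ⇑F = f ∧ ⇑G = (fun p => (x, p)) ∧ F.Homotopic G) →
      ∃ y : 𝕊², (∀ p : 𝕊², (f p).2 = y → Function.Surjective ⇑(mfderiv (𝓡 2) (𝓡 2) (fun q => (f q).2) p)) ∧
        ∃ s : Finset 𝕊², (∀ p : 𝕊², p ∈ s ↔ (f p).2 = y) ∧ Odd s.card)
    (hB : ∀ f : 𝕊² → 𝕊² × 𝕊², Manifold.IsSmoothEmbedding (𝓡 2) ((𝓡 2).prod (𝓡 2)) ∞ f →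
      (∃ (x : 𝕊²) (F G : C(𝕊², 𝕊² × 𝕊²)), ⇑F = f ∧ ⇑G = (fun p => (x, p)) ∧ F.Homotopic G) →
      (∃ y : 𝕊², (∃! p : 𝕊², (f p).2 = y) ∧
        ∀ p : 𝕊², (f p).2 = y → Function.Surjective ⇑(mfderiv (𝓡 2) (𝓡 2) (fun q => (f q).2) p)) →
      ∃ ψ : (𝕊² × 𝕊²) ≃ₘ⟮(𝓡 2).prod (𝓡 2), (𝓡 2).prod (𝓡 2)⟯ (𝕊² × 𝕊²),
        (∃ (x : 𝕊²) (F G : C(𝕊², 𝕊² × 𝕊²)), ⇑F = ⇑ψ ∘ f ∧ ⇑G = (fun p => (x, p)) ∧ F.Homotopic G) ∧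
        μH[2] (Set.range (⇑ψ ∘ f)) < 3 * μH[2] (Set.univ : Set 𝕊²))
    (hC : ∀ f : 𝕊² → 𝕊² × 𝕊², Manifold.IsSmoothEmbedding (𝓡 2) ((𝓡 2).prod (𝓡 2)) ∞ f →
      (∃ (x : 𝕊²) (F G : C(𝕊², 𝕊² × 𝕊²)), ⇑F = f ∧ ⇑G = (fun p => (x, p)) ∧ F.Homotopic G) →
      SimplyConnectedSpace ↥(Set.range f)ᶜ → ∀ k : ℕ, 3 ≤ k → Odd k →
      (∃ y : 𝕊², (∀ p : 𝕊², (f p).2 = y → Function.Surjective ⇑(mfderiv (𝓡 2) (𝓡 2) (fun q => (f q).2) p)) ∧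
        ∃ s : Finset 𝕊², (∀ p : 𝕊², p ∈ s ↔ (f p).2 = y) ∧ s.card = k) →
      ∃ ψ : (𝕊² × 𝕊²) ≃ₘ⟮(𝓡 2).prod (𝓡 2), (𝓡 2).prod (𝓡 2)⟯ (𝕊² × 𝕊²),
        (∃ (x : 𝕊²) (F G : C(𝕊², 𝕊² × 𝕊²)), ⇑F = ⇑ψ ∘ f ∧ ⇑G = (fun p => (x, p)) ∧ F.Homotopic G) ∧
        ∃ j : ℕ, j < k ∧ Odd j ∧
          ∃ y : 𝕊², (∀ p : 𝕊², ((⇑ψ ∘ f) p).2 = y →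
              Function.Surjective ⇑(mfderiv (𝓡 2) (𝓡 2) (fun q => ((⇑ψ ∘ f) q).2) p)) ∧
            ∃ s : Finset 𝕊², (∀ p : 𝕊², p ∈ s ↔ ((⇑ψ ∘ f) p).2 = y) ∧ s.card = j) :
    ∀ f : 𝕊² → 𝕊² × 𝕊², Manifold.IsSmoothEmbedding (𝓡 2) ((𝓡 2).prod (𝓡 2)) ∞ f →
      (∃ (x : 𝕊²) (F G : C(𝕊², 𝕊² × 𝕊²)), ⇑F = f ∧ ⇑G = (fun p => (x, p)) ∧ F.Homotopic G) →
      SimplyConnectedSpace ↥(Set.range f)ᶜ →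
      ∃ ψ : (𝕊² × 𝕊²) ≃ₘ⟮(𝓡 2).prod (𝓡 2), (𝓡 2).prod (𝓡 2)⟯ (𝕊² × 𝕊²),
        (∃ (x : 𝕊²) (F G : C(𝕊², 𝕊² × 𝕊²)), ⇑F = ⇑ψ ∘ f ∧ ⇑G = (fun p => (x, p)) ∧ F.Homotopic G) ∧
        μH[2] (Set.range (⇑ψ ∘ f)) < 3 * μH[2] (Set.univ : Set 𝕊²) := by
  -- the claim for every witnessed odd regular sheet count `k`, by strong induction on `k`
  suffices key : ∀ (k : ℕ) (g : 𝕊² → 𝕊² × 𝕊²), Manifold.IsSmoothEmbedding (𝓡 2) ((𝓡 2).prod (𝓡 2)) ∞ g →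
      (∃ (x : 𝕊²) (F G : C(𝕊², 𝕊² × 𝕊²)), ⇑F = g ∧ ⇑G = (fun p => (x, p)) ∧ F.Homotopic G) →
      SimplyConnectedSpace ↥(Set.range g)ᶜ → Odd k →
      (∃ y : 𝕊², (∀ p : 𝕊², (g p).2 = y → Function.Surjective ⇑(mfderiv (𝓡 2) (𝓡 2) (fun q => (g q).2) p)) ∧
        ∃ s : Finset 𝕊², (∀ p : 𝕊², p ∈ s ↔ (g p).2 = y) ∧ s.card = k) →
      ∃ ψ : (𝕊² × 𝕊²) ≃ₘ⟮(𝓡 2).prod (𝓡 2), (𝓡 2).prod (𝓡 2)⟯ (𝕊² × 𝕊²),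
        (∃ (x : 𝕊²) (F G : C(𝕊², 𝕊² × 𝕊²)), ⇑F = ⇑ψ ∘ g ∧ ⇑G = (fun p => (x, p)) ∧ F.Homotopic G) ∧
        μH[2] (Set.range (⇑ψ ∘ g)) < 3 * μH[2] (Set.univ : Set 𝕊²) by
    intro f hemb hcls hsc
    obtain ⟨y, hreg, s, hs, hodd⟩ := hA f hemb hcls
    exact key s.card f hemb hcls hsc hodd ⟨y, hreg, s, hs, rfl⟩
  intro k
  induction k using Nat.strong_induction_on with
  | h k ih =>
    intro g hgemb hgcls hgsc hodd hcount
    obtain ⟨m, hm⟩ := hodd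
    rcases Nat.eq_zero_or_pos m with hm0 | hmpos
    · -- `k = 1`: a one-sheet regular height — the light bulb base
      subst hm0
      have hk1 : k = 1 := by omega
      obtain ⟨y, hreg, s, hs, hcard⟩ := hcount
      rw [hk1] at hcard
      obtain ⟨p₀, hp₀⟩ := Finset.card_eq_one.mp hcard
      have hone : ∃ y : 𝕊², (∃! p : 𝕊², (g p).2 = y) ∧
          ∀ p : 𝕊², (g p).2 = y → Function.Surjective ⇑(mfderiv (𝓡 2) (𝓡 2) (fun q => (g q).2) p) := by
        refine ⟨y, ⟨p₀, (hs p₀).mp (by simp [hp₀]), fun p hp => ?_⟩, hreg⟩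
        have hp' := (hs p).mpr hp
        simpa [hp₀] using hp'
      exact hB g hgemb hgcls hone
    · -- `k ≥ 3`: descend and apply the induction hypothesis to `ψ₁ ∘ g`
      have hk3 : 3 ≤ k := by omega
      obtain ⟨ψ₁, hcls₁, j, hj, hjodd, hcount₁⟩ := hC g hgemb hgcls hgsc k hk3 ⟨m, hm⟩ hcount
      obtain ⟨ψ₂, hcls₂, harea₂⟩ := ih j hj (⇑ψ₁ ∘ g) (isSmoothEmbedding_diffeomorph_comp ψ₁ hgemb) hcls₁
        (simplyConnectedSpace_compl_range_comp ψ₁ hgsc) hjodd hcount₁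
      have hcomp : ⇑(ψ₁.trans ψ₂) ∘ g = ⇑ψ₂ ∘ (⇑ψ₁ ∘ g) := by
        funext p
        simp [Diffeomorph.coe_trans]
      refine ⟨ψ₁.trans ψ₂, ?_, ?_⟩
      · rw [hcomp]; exact hcls₂
      · rw [hcomp]; exact harea₂

/-- **THE SKELETON THEOREM.** The crux `Summit.SmoothPoincare4.SmoothPoincare4.Theses.ThreeFibres.AreaBelowThreeFibres`,
concluded BY NAME from the three DECLARED stubs `stub_odd_regular_sheet`, `stub_one_sheet_below_three`,
`stub_sheet_descent` (the only `sorry`s of the file) through the sorry-free composition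
`areaBelowThreeFibres_of_pieces`. [folklore] -/
theorem AreaBelowThreeFibres_of :
    Summit.SmoothPoincare4.SmoothPoincare4.Theses.ThreeFibres.AreaBelowThreeFibres :=
  areaBelowThreeFibres_of_pieces stub_odd_regular_sheet stub_one_sheet_below_three stub_sheet_descent

end Summit.SmoothPoincare4.SmoothPoincare4.Cruxes.AreaBelowThreeFibres.Birth
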